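import Summits.HodgeConjecture.CorCM.MumfordTateRankFourCM
import HarnessLib

/-!
# The Mumford–Tate rank `4`, CM side, II: both degenerate shapes DO have `dim MT(H¹(X)) = 4` and a power carrying an
# exceptional Hodge class — the classification of `CorCM/MumfordTateRankFourCM` is sharp

COR-CM (cell `pub-hodgecm2`, seat `b27` gen 32, count-neutral lane MT-RANK-FOUR-CM, file 2; theorems only, no definition,
no named fact; UNCONDITIONAL).  NEW as stated (an assembly of tree theorems), hence under `Summits/`.
`CorCM/MumfordTateRankFourCM` shows: a complex abelian variety `X` of CM type with `dim MT(H¹(X)) = 4` some power of which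
is not divisor-generated is EITHER isogenous to a product of copies of ONE simple CM fourfold `A` with `B(A) ≠ D(A)`
(`dim MT(H¹(A)) = 4`: Weil type, Gordon 5.13 (ii)), OR isogenous to a product of copies of a CM elliptic curve `E ⊨ (k; Ψ)`
and of a simple CM threefold `T ⊨ (K; Φ)` with `k ↪ K` (Moonen–Zarhin (0.2) (a)).  Here the converses:

* `mtRank_hodge_one_eq_four_of_isIsogenous_biproduct_fourfold` — `X ∼ ⨁_{Fin (m+1)} A` with `A` a simple complex abelian
  fourfold of CM type and `B(A) ≠ D(A)` ⟹ `dim MT(H¹(X)) = 4` and some power `X^{N+1}` is not divisor-generated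
  (`dim MT(H¹(A)) ∈ {4, 5}` with `5 ⟺ B(A) = D(A)`, `Pohlmann1968/SimpleCMAbelianFourfoldPowers`; `A ∼ ⨁_{Fin 1} A` is an
  isogeny factor of a power of `X`, `CorCM/BiproductSlotsDomination`);
* `mtRank_hodge_one_eq_four_of_isIsogenous_biproduct_curve_threefold` — family form over two slots `i₀ ≠ i₁` with
  `[K_{i₀}:ℚ] = 2`, `[K_{i₁}:ℚ] = 6`, `A'_{i₁}` simple and `e : K_{i₀} →+* K_{i₁}`: every `X ∼ ⨁_j A'_{cls j}` (`cls`
  onto) has `dim MT(H¹(X)) = 4` and a power that is not divisor-generated (the pair is DEGENERATE by Moonen–Zarhin's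
  criterion, so `dim MT ≠ rdim + 1 = 5`; Ribet's bound `16 ≤ 2^{dim MT}` gives `≥ 4`).

HONEST FRAMING: unconditional structure theorems on Mumford–Tate groups of CM abelian varieties; `HC_CM` is neither used
nor asserted.

## References

* [MoonenZarhin1999LowDim] B. Moonen, Yu. Zarhin, *Hodge classes on abelian varieties of low dimension*, Math. Ann.
  315 (1999) 711–733, Thm. (0.1), Thm. (0.2) (a) and (1).
* [MoonenZarhin1995Duke] B. Moonen, Yu. Zarhin, *Hodge classes and Tate classes on simple abelian fourfolds*, Duke
  Math. J. 77 (1995), Thm. 2.4.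
* [Gordon1999HodgeAVSurvey] B. B. Gordon, *A survey of the Hodge conjecture for abelian varieties*, 5.13, 7.5–7.7, 9.4.
* [Dodson1987] B. Dodson, J. Algebra 111 (1987), Thm. 1.0 (iii); [Ribet1980] K. A. Ribet, Mém. SMF 2 (1980), §3 (3.5), (3.7).
-/

noncomputable section

open CategoryTheory CategoryTheory.Limits NumberField Module
open scoped BigOperators

namespace Summit.HodgeConjecture.CorCM

open Literature.NumberTheory.ComplexMultiplication
open Literature.AlgebraicGeometry.Motives
open Literature.AlgebraicGeometry.Motives.AbelianVariety
open Literature.AlgebraicGeometry.HodgeTheory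
open Literature.AlgebraicGeometry.ComplexMultiplication (IsCMTypeRealisation)
open Literature.AlgebraicGeometry.Milne1999 (IsOfCMType)
open Literature.AlgebraicGeometry.Pohlmann1968

/-! ## Converses: both shapes have Mumford–Tate rank `4` and a power with an exceptional class -/

section Converse

variable [HodgeTensorFacts.{0, 0}] {X : AbelianVariety ℂ} {n : ℕ} (hX : IsSmoothProjective n X.X)

/-- **Powers of a simple CM fourfold of Weil type have Mumford–Tate rank `4`**: if `X ∼ ⨁_{Fin (m+1)} A` with `A` a simple
complex abelian fourfold of CM type with `B(A) ≠ D(A)`, then `dim MT(H¹(X)) = 4` and some power of `X` is not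
divisor-generated. [cite: Gordon1999HodgeAVSurvey, 5.13 (ii) and 7.6.1] [cite: MoonenZarhin1995Duke, Thm. 2.4] -/
theorem mtRank_hodge_one_eq_four_of_isIsogenous_biproduct_fourfold {A : AbelianVariety ℂ} {m : ℕ} (hs : A.IsSimple)
    (hA4 : A.dim = 4) (hcm : IsOfCMType A) (hnd : ¬ IsDivisorGenerated A)
    (hXB : IsIsogenous X (⨁ fun _ : Fin (m + 1) => A)) :
    haveI := BettiUniverse.finite hX 1
    (BettiUniverse.hodge exists_isReal_hodgeModel_holds hX 1).mtRank = 4 ∧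
      ¬ ∀ N : ℕ, IsDivisorGenerated (X.powSucc N) := by
  classical
  -- a typed model of `A`: `A ∼ ⨁_{Fin 1} A'` with `A' ⊨ (K; Φ)` primitive octic
  obtain ⟨K, _, _, _, Φ, A', ι, θ, s₀, hR, hiso, hK, -, -⟩ :=
    exists_realisation_mtRank_eq (AbelianVariety.isSmoothProjective_holds (A := A)) hs (by omega) hcm
  have hA' : ∀ c : Unit, IsCMTypeRealisation ((fun _ => Φ) c) ((fun _ => A') c) ((fun _ => ι) c) ((fun _ => θ) c) :=
    fun _ => hR
  have hclsA : Function.Surjective (fun _ : Fin 1 => ()) := fun _ => ⟨0, rfl⟩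
  have hclsX : Function.Surjective (fun _ : Fin (m + 1) => ()) := fun _ => ⟨0, rfl⟩
  obtain ⟨g, hg⟩ := hiso
  have hAB : IsIsogenous A (⨁ fun _ : Fin 1 => A') :=
    (isIsogenous_powSucc_biproduct A 0).trans
      ⟨biproduct.map fun _ => g, Literature.AlgebraicGeometry.Milne1999.isIsogeny_biproduct_map fun _ => hg⟩
  have hXB' : IsIsogenous X (⨁ fun _ : Fin (m + 1) => A') :=
    hXB.trans ⟨biproduct.map fun _ => g, Literature.AlgebraicGeometry.Milne1999.isIsogeny_biproduct_map fun _ => hg⟩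
  have hmtA := mtRank_hodge_one_eq_cmFamilyRank_of_isIsogenous_biproduct hA' hclsA
    (AbelianVariety.isSmoothProjective_holds (A := A)) hAB
  have hmtX := mtRank_hodge_one_eq_cmFamilyRank_of_isIsogenous_biproduct hA' hclsX hX hXB'
  have h45 := mtRank_hodge_one_eq_four_or_five_of_dim_four (AbelianVariety.isSmoothProjective_holds (A := A)) hs hA4 hcm
  have h5 := isDivisorGenerated_iff_mtRank_eq_five_of_dim_four (AbelianVariety.isSmoothProjective_holds (A := A)) hs hA4
    hcm
  have hmtA4 : haveI := BettiUniverse.finite (AbelianVariety.isSmoothProjective_holds (A := A)) 1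
      (BettiUniverse.hodge exists_isReal_hodgeModel_holds (AbelianVariety.isSmoothProjective_holds (A := A)) 1).mtRank = 4 := by
    rcases h45 with h | h
    · exact h
    · exact absurd (h5.2 h) hnd
  have hX4 : haveI := BettiUniverse.finite hX 1
      (BettiUniverse.hodge exists_isReal_hodgeModel_holds hX 1).mtRank = 4 := by rw [hmtX, ← hmtA, hmtA4]
  refine ⟨hX4, fun hall => hnd ?_⟩
  -- `A ∼ ⨁_{Fin 1} A` is an isogeny factor of `X^{N+1}` for some `N`, and `B = D` descends
  obtain ⟨N, hdom⟩ := exists_avDominatedBy_biproduct_slots_powSucc (A' := fun _ : Unit => A)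
    (cls := fun _ : Fin (m + 1) => ()) hclsX hXB (fun _ : Fin 1 => ())
  exact IsDivisorGenerated.of_isIsogenous (isIsogenous_powSucc_biproduct A 0)
    (isDivisorGenerated_of_avDominatedBy hdom (hall N))

/-- **`E^c × T^a` with `k ↪ K` has Mumford–Tate rank `4`**: if `X ∼ ⨁_j ![E, T] (κ j)` (`κ` onto `Fin 2`) with `T` a simple CM
threefold of the sextic CM field `K`, `E` a CM elliptic curve of the imaginary quadratic field `k` and `i : k →+* K`, then
`dim MT(H¹(X)) = 4` and some power of `X` is NOT divisor-generated (`Hg(E × T) = Hg(T)` has rank `3 = rdim − 1`;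
Moonen–Zarhin (0.2) (a)). [cite: MoonenZarhin1999LowDim, Thm. (0.2) (a)] [cite: Gordon1999HodgeAVSurvey, 7.5 and 7.7]
[cite: Dodson1987, Thm. 1.0 (iii)] -/
theorem mtRank_hodge_one_eq_four_of_isIsogenous_biproduct_curve_threefold {I : Type} [Fintype I] [DecidableEq I]
    {K' : I → Type} [∀ i, Field (K' i)] [∀ i, NumberField (K' i)] [∀ i, IsCMField (K' i)] {Φ' : ∀ i, CMType (K' i)}
    {A' : I → AbelianVariety ℂ} {ι' : ∀ i, 𝓞 (K' i) →+* End (A' i)}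
    {θ' : ∀ i, K' i →+* Module.End ℂ (complexBetti (A' i).X 1)} {i₀ i₁ : I} (h01 : i₀ ≠ i₁)
    (hI : ∀ j, j = i₀ ∨ j = i₁) (h2 : finrank ℚ (K' i₀) = 2) (h6 : finrank ℚ (K' i₁) = 6) (e : K' i₀ →+* K' i₁)
    (hA : ∀ i, IsCMTypeRealisation (Φ' i) (A' i) (ι' i) (θ' i)) (hTs : (A' i₁).IsSimple)
    {J : Type} [Fintype J] [DecidableEq J] {cls : J → I} (hcls : Function.Surjective cls)
    (hXB : IsIsogenous X (⨁ fun j => A' (cls j))) :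
    haveI := BettiUniverse.finite hX 1
    (BettiUniverse.hodge exists_isReal_hodgeModel_holds hX 1).mtRank = 4 ∧
      ¬ ∀ N : ℕ, IsDivisorGenerated (X.powSucc N) := by
  haveI : Nonempty I := ⟨i₀⟩
  have hdE : (A' i₀).dim = 1 := by have := finrank_eq_two_mul_dim_of_isCMTypeRealisation (hA i₀); omega
  have hdT : (A' i₁).dim = 3 := by have := finrank_eq_two_mul_dim_of_isCMTypeRealisation (hA i₁); omega
  -- the curve is simple and not isogenous to the threefold
  have hs : ∀ i, (A' i).IsSimple := fun i => by
    rcases hI i with rfl | rfl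
    · exact isSimple_of_dim_le_one hdE.le
    · exact hTs
  have hniso : ∀ c c', c ≠ c' → ¬ IsIsogenous (A' c) (A' c') := by
    intro c c' hcc' ⟨g, hg⟩
    have hdim := dim_eq_of_isIsogeny hg
    rcases hI c with rfl | rfl <;> rcases hI c' with rfl | rfl
    · exact hcc' rfl
    · rw [hdE, hdT] at hdim; omega
    · rw [hdT, hdE] at hdim; omega
    · exact hcc' rfl
  -- `rdim = 1 + 3 = 4`
  have hsum : ∑ c, (A' c).dim = 4 := by
    have huniv : (Finset.univ : Finset I) = {i₀, i₁} := by
      ext c; simpa using hI c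
    rw [huniv, Finset.sum_pair h01, hdE, hdT]
  -- the family is degenerate (`k ↪ K`), so `dim MT ≠ rdim + 1 = 5`; Ribet gives `dim MT ≥ 4`, Kubota `≤ 5`
  have hdeg : ¬ CMAlgebra.IsNondegenerateFamily Φ' := fun hnd =>
    ((isNondegenerateFamily_iff_isEmpty_of_quadratic_slot' h01 hI h2 h6.le hA hs hniso).1 hnd).false e
  have hnd := isNondegenerateFamily_iff_mtRank_hodge_one_eq hA hcls hX hXB
  have hle := mtRank_hodge_one_le_sum_dim_add_one_of_isIsogenous_biproduct hA hcls hX hXB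
  have hrib := four_mul_sum_dim_le_two_pow_mtRank_hodge_one hA hs hniso hcls hX hXB
  have hiff := forall_isDivisorGenerated_powSucc_iff_mtRank_hodge_one_eq hA hs hniso hcls hX hXB
  rw [hsum] at hnd hle hrib hiff
  have hne5 : haveI := BettiUniverse.finite hX 1
      (BettiUniverse.hodge exists_isReal_hodgeModel_holds hX 1).mtRank ≠ 5 := fun h5 => hdeg (hnd.2 h5)
  have h4 : haveI := BettiUniverse.finite hX 1
      (BettiUniverse.hodge exists_isReal_hodgeModel_holds hX 1).mtRank = 4 := by
    haveI := BettiUniverse.finite hX 1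
    have hge : 4 ≤ (BettiUniverse.hodge exists_isReal_hodgeModel_holds hX 1).mtRank := by
      by_contra hlt
      push Not at hlt
      interval_cases h : (BettiUniverse.hodge exists_isReal_hodgeModel_holds hX 1).mtRank <;> omega
    omega
  exact ⟨h4, fun hall => hne5 (hiff.1 hall)⟩

end Converse

end Summit.HodgeConjecture.CorCM

end
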